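import Summits.BirchSwinnertonDyer.Rank1Residual.Additive.XMultRankZeroCyclotomicThreeX4Facts
import Literature.NumberTheory.EllipticCurves.Wuthrich2014.ThreeAdicImage
import HarnessLib

/-!
# X4 (M)-rows at `p = 3`, `V` NON-SPLIT multiplicative: the image hypothesis from `surj(3)` ALONE via
# Wuthrich 2014 Lemma 20 (line V15, the rows without a `ram` prime)

HONEST FRAMING (cell `b2b-bsdres`, run/shared/lean/b2b/bsd-rank1-residual/, verbatim in every
file): the goal of the cell is to DELETE the COMBINATION-SHAPED residual classes of the
Birch–Swinnerton-Dyer formula for ALL analytic-rank `≤ 1` elliptic curves over `ℚ` — "full BSD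
formula for every rank `≤ 1` curve in class `C`" assembled STRICTLY from published theorems — so
that the rank-`≤ 1` remainder becomes exactly the CONSTRUCTION-SHAPED classes, which are TYPED
(missing-input `Prop`s), NOT attempted. This is not "finishing BSD". Seat additive-p4 (research route
on X3/X4), gen 6; the label of X4 is UNCHANGED by this file; nothing is booked here (referee).

Theorems only (no `def`, no `sorry`, no new named fact). In `XMultRankZeroCyclotomicThreeX4Facts` the
`3`-adic surjectivity of the twist `V` is supplied from the census bits `surj(3) ∧ ram(3)` of `W`. Since
`V` is MULTIPLICATIVE at `3`, Wuthrich 2014 Lemma 20 (p. 399: "Let `p = 3` and suppose `p²` does not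
divide the conductor `N`. If `ρ̄` is surjective then `ρ` is surjective, too"; tree NAMED FACT
`Wuthrich2014.lemma20_surjective_threeAdic_of_semistable`) gives `ρ̄_{V,3ⁿ}` onto for all `n` from
`surj(3)` of `V` alone, and `surj(3)` is twist-invariant (`surj_iff_of_model_twist`). Hence the V15
corollaries with `hram` replaced by the named fact `hL20`: the 2 CORE-open rank-`(0,0)` rows without a
`ram` prime (5175x1, 5256e1; engine A) are reached too. Labels UNCHANGED; nothing booked.
-/

noncomputable section

open scoped Classical MatrixGroups ModularForm

open CongruenceSubgroup WeierstrassCurve NumberField IsDedekindDomain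
  Literature.NumberTheory.EllipticCurves Literature.NumberTheory.EllipticCurves.ModularForms
  Literature.NumberTheory.EllipticCurves.Rank1Residual
  Literature.NumberTheory.EllipticCurves.Rank1Residual.Typed
  Literature.NumberTheory.GaloisRepresentations

namespace Summit.BirchSwinnertonDyer.Rank1Residual.Additive

variable (V : WeierstrassCurve ℚ) [V.IsElliptic] [V.IsGloballyMinimal]
  (W : WeierstrassCurve ℚ) [W.IsElliptic] [W.IsGloballyMinimal]

omit [V.IsGloballyMinimal] [W.IsElliptic] [W.IsGloballyMinimal] in
/-- **`ρ̄_{V,3ⁿ}` onto for all `n` from `surj(3)` of the additive curve `W ≅ V^{(−3)}`, `V` multiplicative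
at `3`** (Wuthrich 2014 Lemma 20 as the named fact `hL20`; `surj(3)` is invariant under the quadratic
twist). [cite: Wuthrich2014, Lemma 20 (p. 399)] -/
theorem forall_surj_pow_of_twist_of_surj_of_lemma20
    (hL20 : Wuthrich2014.lemma20_surjective_threeAdic_of_semistable)
    (C : VariableChange ℚ) (hC : C • V.quadraticTwist (-(3 : ℚ)) = W)
    (hmult : V.HasMultiplicativeReductionAtPrime 3) (hsurj : Surj W 3) (n : ℕ) :
    V.HasSurjectiveModNGaloisRep (3 ^ n : ℕ) :=
  hL20 V (Or.inr hmult) ((surj_iff_of_model_twist V 3 (d := -(3 : ℚ)) (by norm_num) ⟨C, hC⟩).mp hsurj) n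

/-- **Line V15 (X4), core inequality, image from `surj(3)` alone** (`V` non-split multiplicative at
`3`, Lemma 20 as the named fact `hL20`): `ord₃ #Ш(V) + ord₃ #Ш(W) ≤ ord₃ #Ш_an(V) + ord₃ #Ш_an(W)`.
[cite: Wuthrich2014, Thm. 3 (p. 383), Cor. 19 and Lemma 20 (pp. 398–399)] [cite: GreenbergLNM1716, §4 pp. 112–113] -/
theorem XMultCyclotomicThree.exists_padicVal_shaOrder_add_le_of_facts_of_surj_of_lemma20
    (hKato : Wuthrich2014.kato_charIdeal_dvd_nonsplitMultiplicative_cyclotomicThree_of_surjective)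
    (hGr : Greenberg1999.thm41Analogue_charValue_rankZero_numberField)
    (hL20 : Wuthrich2014.lemma20_surjective_threeAdic_of_semistable)
    (hMilne : Milne1972.bsdQuotient_baseChange_quadratic_anyModel)
    (hGZK : rank_eq_analyticRank_of_analyticRank_le_one) (hmod : hasEntireLFunction_rat)
    (hmodD : nonempty_modularParametrizationData)
    (C : VariableChange ℚ) (hC : C • V.quadraticTwist (-(3 : ℚ)) = W)
    (hmult : V.HasMultiplicativeReductionAtPrime 3) (hns : ¬ V.HasSplitMultiplicativeReductionAtPrime 3)
    (hsurj : Surj W 3) (hadd : Addv W 3) (hrV : V.analyticRank = 0) (hrW : W.analyticRank = 0) :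
    ∃ qV qW : ℚ, shaAn V = (qV : ℂ) ∧ shaAn W = (qW : ℂ) ∧
      (padicValNat 3 V.shaOrder : ℤ) + padicValNat 3 W.shaOrder ≤ padicValRat 3 qV + padicValRat 3 qW :=
  XMultCyclotomicThree.exists_padicVal_shaOrder_add_le_of_facts_of_surj_pow V W hKato hGr hMilne hGZK hmod
    hmodD C hC hmult hns (forall_surj_pow_of_twist_of_surj_of_lemma20 V W hL20 C hC hmult hsurj) hadd hrV
    hrW

/-- **The typed UPPER half, image from `surj(3)` alone** (`3 ∤ #Ш_an(V)`).
[cite: Wuthrich2014, Cor. 19 and Lemma 20 (pp. 398–399)] -/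
theorem XMultCyclotomicThree.missingUpperBoundAt_of_facts_of_surj_of_lemma20
    (hKato : Wuthrich2014.kato_charIdeal_dvd_nonsplitMultiplicative_cyclotomicThree_of_surjective)
    (hGr : Greenberg1999.thm41Analogue_charValue_rankZero_numberField)
    (hL20 : Wuthrich2014.lemma20_surjective_threeAdic_of_semistable)
    (hMilne : Milne1972.bsdQuotient_baseChange_quadratic_anyModel)
    (hGZK : rank_eq_analyticRank_of_analyticRank_le_one) (hmod : hasEntireLFunction_rat)
    (hmodD : nonempty_modularParametrizationData)
    (C : VariableChange ℚ) (hC : C • V.quadraticTwist (-(3 : ℚ)) = W)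
    (hmult : V.HasMultiplicativeReductionAtPrime 3) (hns : ¬ V.HasSplitMultiplicativeReductionAtPrime 3)
    (hsurj : Surj W 3) (hadd : Addv W 3) (hrV : V.analyticRank = 0) (hrW : W.analyticRank = 0)
    {qV : ℚ} (hqV : shaAn V = (qV : ℂ)) (hv : padicValRat 3 qV ≤ 0) :
    MissingUpperBoundAt W 3 := by
  obtain ⟨qV', qW, hqV', hqW, hle⟩ :=
    XMultCyclotomicThree.exists_padicVal_shaOrder_add_le_of_facts_of_surj_of_lemma20 V W hKato hGr hL20
      hMilne hGZK hmod hmodD C hC hmult hns hsurj hadd hrV hrW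
  have hqq : qV' = qV := by exact_mod_cast hqV'.symm.trans hqV
  subst hqq
  refine ⟨qW, hqW, ?_⟩
  have h0 : (0 : ℤ) ≤ padicValNat 3 V.shaOrder := by positivity
  linarith

/-- **`BSD(W,3) ∧ BSD(V,3)` on the doubly-unit rows, image from `surj(3)` alone.**
[cite: Wuthrich2014, Cor. 19 and Lemma 20 (pp. 398–399)] [cite: GreenbergLNM1716, §4 pp. 112–113] -/
theorem XMultCyclotomicThree.bsdp_of_shaAn_units_of_facts_of_surj_of_lemma20
    (hKato : Wuthrich2014.kato_charIdeal_dvd_nonsplitMultiplicative_cyclotomicThree_of_surjective)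
    (hGr : Greenberg1999.thm41Analogue_charValue_rankZero_numberField)
    (hL20 : Wuthrich2014.lemma20_surjective_threeAdic_of_semistable)
    (hMilne : Milne1972.bsdQuotient_baseChange_quadratic_anyModel)
    (hGZK : rank_eq_analyticRank_of_analyticRank_le_one) (hmod : hasEntireLFunction_rat)
    (hmodD : nonempty_modularParametrizationData)
    (C : VariableChange ℚ) (hC : C • V.quadraticTwist (-(3 : ℚ)) = W)
    (hmult : V.HasMultiplicativeReductionAtPrime 3) (hns : ¬ V.HasSplitMultiplicativeReductionAtPrime 3)
    (hsurj : Surj W 3) (hadd : Addv W 3) (hrV : V.analyticRank = 0) (hrW : W.analyticRank = 0)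
    {qV qW : ℚ} (hqV : shaAn V = (qV : ℂ)) (hqW : shaAn W = (qW : ℂ))
    (hvV : padicValRat 3 qV = 0) (hvW : padicValRat 3 qW = 0) : BSDp W 3 ∧ BSDp V 3 := by
  obtain ⟨qV', qW', hqV', hqW', hle⟩ :=
    XMultCyclotomicThree.exists_padicVal_shaOrder_add_le_of_facts_of_surj_of_lemma20 V W hKato hGr hL20
      hMilne hGZK hmod hmodD C hC hmult hns hsurj hadd hrV hrW
  have hqq : qV' = qV := by exact_mod_cast hqV'.symm.trans hqV
  have hqq' : qW' = qW := by exact_mod_cast hqW'.symm.trans hqW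
  subst hqq hqq'
  rw [hvV, hvW, add_zero] at hle
  have hV0 : (0 : ℤ) ≤ padicValNat 3 V.shaOrder := by positivity
  have hW0 : (0 : ℤ) ≤ padicValNat 3 W.shaOrder := by positivity
  have huW : MissingUpperBoundAt W 3 := ⟨qW', hqW', by rw [hvW]; linarith⟩
  have huV : MissingUpperBoundAt V 3 := ⟨qV', hqV', by rw [hvV]; linarith⟩
  exact ⟨bsdp_of_missingPPartAt W 3 hGZK (by rw [hrW]; exact zero_le_one)
      (missingPPartAt_of_upper_of_shaAn_unit W 3 huW hqW' hvW),
    bsdp_of_missingPPartAt V 3 hGZK (by rw [hrV]; exact zero_le_one)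
      (missingPPartAt_of_upper_of_shaAn_unit V 3 huV hqV' hvV)⟩

end Summit.BirchSwinnertonDyer.Rank1Residual.Additive

end
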